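import Summits.RiemannHypothesis.RiemannHypothesis.Theorems.WeilOffLineSplit
import Literature.NumberTheory.LFunctions.WeilMellinInversion
import Literature.NumberTheory.LFunctions.WeilExplicitDirichletConj
import HarnessLib

/-!
# The off-line split in the two sectors: hermitian and anti-hermitian tests

Structure seat rh-explicit-weil-3 (gen6), supporting `stmt-RiemannHypothesis-0098`; sequel of
`WeilOffLineSplit.lean` (`Re Q(g) = ∑ m‖(a+b)/2‖² − ∑ m‖(a−b)/2‖²`, `a = ĝ(ρ)`, `b = ĝ(1 − ρ̄)`).
Everything PROVED.

For a HERMITIAN test (`g(−x) = conj g(x)`: e.g. an even real-valued `h`, or `h(x)e^{−iγ₀x}` with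
`h` even real) the reflected value is `ĝ(1 − ρ̄) = conj ĝ(ρ)` (`weilMellin_reflect_of_hermitian`), so the
line part is `Re ĝ(ρ)` and the off-line part is `i·Im ĝ(ρ)`:

  `Re Q(g) = ∑_ρ m(ρ) (Re ĝ(ρ))² − ∑_ρ m(ρ) (Im ĝ(ρ))²`   (`re_weilQuadratic_eq_of_hermitian`).

For an ANTI-HERMITIAN test (`g(−x) = −conj g(x)`: an odd real `h`, or `h(x)e^{−iγ₀x}` with `h` odd
real — the modulated odd witness of Yoshida 1992, Prop. 1 / Bombieri 2000 §13,
`antiHermitian_modulate_of_odd_real`) it is `ĝ(1 − ρ̄) = −conj ĝ(ρ)`, and the roles swap: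

  `Re Q(g) = ∑_ρ m(ρ) (Im ĝ(ρ))² − ∑_ρ m(ρ) (Re ĝ(ρ))²`   (`re_weilQuadratic_eq_of_antiHermitian`).

On the critical line `ĝ(1 − ρ̄) = ĝ(ρ)`, so the subtracted square vanishes there in both sectors
(`im_weilMellin_eq_zero_of_hermitian`, `re_weilMellin_eq_zero_of_antiHermitian`): the negative series
is carried by the off-line zeros, with amplitude `Im ĝ(ρ) = ∫ g·sinh((β−½)x)…` resp. `Re ĝ(ρ)`.
Reading (Yoshida's Prop. 1 made quantitative): a zero `β + iγ` off the line lowers the form of an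
anti-hermitian test by exactly `m (Re ĝ(β+iγ))²`, where for `g = h e^{−iγ₀·}`, `h` odd real,
`Re ĝ(β+iγ) = ∫ h(x) sinh((β−½)x) cos((γ−γ₀)x) dx`; of a hermitian test by `m (Im ĝ)²` with
`Im ĝ = ∫ h(x) sinh((β−½)x) sin((γ−γ₀)x) dx` (`h` even real) — which vanishes at `γ = γ₀`: an
even window centred on the zero's own ordinate does not see it (the even sector's blind spot).
References: H. Yoshida 1992, Prop. 1 (p. 285); E. Bombieri 2000, §13.
-/

noncomputable section

set_option linter.dupNamespace false  -- the mandated namespace repeats `RiemannHypothesis`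

open Complex Filter Set MeasureTheory Topology
open scoped Real ComplexConjugate

namespace Summit.RiemannHypothesis.RiemannHypothesis.Theorems.WeilOffLine

open Literature.NumberTheory.LFunctions Literature.NumberTheory.LFunctions.WeilConverse

/-! ### Reflected values for (anti-)hermitian tests -/

/-- **Hermitian tests**: if `g(−x) = conj g(x)` then `ĝ(1 − ρ̄) = conj ĝ(ρ)` for every `ρ`
(`(g(−·))^(s) = ĝ(1 − s)` and `(conj g)^(s) = conj ĝ(conj s)`). [folklore] -/
theorem weilMellin_reflect_of_hermitian {g : ℝ → ℂ} (hg : ∀ x, g (-x) = conj (g x)) (ρ : ℂ) :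
    weilMellin g (1 - conj ρ) = conj (weilMellin g ρ) := by
  have h1 := weilMellin_comp_neg g (conj ρ)
  have h2 : (fun t : ℝ ↦ g (-t)) = fun t ↦ conj (g t) := funext hg
  rw [h2, weilMellin_conj, Complex.conj_conj] at h1
  exact h1.symm

/-- **Anti-hermitian tests**: if `g(−x) = −conj g(x)` then `ĝ(1 − ρ̄) = −conj ĝ(ρ)`. [folklore] -/
theorem weilMellin_reflect_of_antiHermitian {g : ℝ → ℂ} (hg : ∀ x, g (-x) = -conj (g x)) (ρ : ℂ) :
    weilMellin g (1 - conj ρ) = -conj (weilMellin g ρ) := by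
  have h1 := weilMellin_comp_neg g (conj ρ)
  have h2 : (fun t : ℝ ↦ g (-t)) = fun t ↦ (-1 : ℂ) * conj (g t) := funext fun t ↦ by
    rw [hg t]; ring
  rw [h2, weilMellin_const_mul, weilMellin_conj, Complex.conj_conj] at h1
  rw [← h1]; ring

/-- On the critical line a hermitian test has REAL transform: `Im ĝ(ρ) = 0` if `Re ρ = 1/2`. [folklore] -/
theorem im_weilMellin_eq_zero_of_hermitian {g : ℝ → ℂ} (hg : ∀ x, g (-x) = conj (g x)) {ρ : ℂ}
    (hρ : ρ.re = 1 / 2) : (weilMellin g ρ).im = 0 := by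
  have h := weilMellin_sub_reflect_eq_zero g hρ
  rw [weilMellin_reflect_of_hermitian hg, Complex.sub_conj] at h
  have : ((2 * (weilMellin g ρ).im : ℝ) : ℂ) = 0 := by
    rcases mul_eq_zero.1 h with h' | h'
    · exact h'
    · exact absurd h' Complex.I_ne_zero
  have := Complex.ofReal_eq_zero.1 this
  linarith

/-- On the critical line an anti-hermitian test has IMAGINARY transform: `Re ĝ(ρ) = 0` if
`Re ρ = 1/2`. [folklore] -/
theorem re_weilMellin_eq_zero_of_antiHermitian {g : ℝ → ℂ} (hg : ∀ x, g (-x) = -conj (g x))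
    {ρ : ℂ} (hρ : ρ.re = 1 / 2) : (weilMellin g ρ).re = 0 := by
  have h := weilMellin_sub_reflect_eq_zero g hρ
  rw [weilMellin_reflect_of_antiHermitian hg, sub_neg_eq_add, Complex.add_conj] at h
  have := Complex.ofReal_eq_zero.1 h
  linarith

/-- The two halves for a hermitian test: `‖(a + conj a)/2‖² = (Re a)²`, `‖(a − conj a)/2‖² = (Im a)²`.
[folklore] -/
theorem norm_sq_halves_of_conj (a : ℂ) :
    ‖(a + conj a) / 2‖ ^ 2 = a.re ^ 2 ∧ ‖(a - conj a) / 2‖ ^ 2 = a.im ^ 2 := by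
  rw [Complex.add_conj, Complex.sub_conj]
  constructor
  · rw [show ((2 * a.re : ℝ) : ℂ) / 2 = ((a.re : ℝ) : ℂ) by push_cast; ring, Complex.norm_real,
      Real.norm_eq_abs, sq_abs]
  · rw [show ((2 * a.im : ℝ) : ℂ) * I / 2 = ((a.im : ℝ) : ℂ) * I by push_cast; ring, norm_mul,
      Complex.norm_I, mul_one, Complex.norm_real, Real.norm_eq_abs, sq_abs]

/-! ### Summability of the sector series -/

/-- `∑ m(ρ) (Re ĝ(ρ))²` converges for a test function. [folklore] -/
theorem summable_re_sq {g : ℝ → ℂ} (hg : IsWeilTest g) :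
    Summable fun ρ : ZetaZeros.riemannZetaNontrivialZeros ↦
      (riemannZetaZeroOrder (ρ : ℂ) : ℝ) * (weilMellin g ρ).re ^ 2 := by
  refine summable_zeroOrder_mul_of_le (x := fun ρ ↦ (weilMellin g ρ).re ^ 2)
    (K := weilDecayConst g ^ 2) (fun ρ _ ↦ sq_nonneg _) fun ρ hρ ↦ ?_
  have h := norm_weilMellin_le hg (ZetaZeros.riemannZetaNontrivialZeros.re_pos hρ).le
    (ZetaZeros.riemannZetaNontrivialZeros.re_lt_one hρ).le
  have h2 : |(weilMellin g ρ).re| ≤ weilDecayConst g / (1 + ρ.im ^ 2) :=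
    (Complex.abs_re_le_norm _).trans h
  calc (weilMellin g ρ).re ^ 2 = |(weilMellin g ρ).re| ^ 2 := (sq_abs _).symm
    _ ≤ (weilDecayConst g / (1 + ρ.im ^ 2)) ^ 2 := pow_le_pow_left₀ (abs_nonneg _) h2 2
    _ = weilDecayConst g ^ 2 / (1 + ρ.im ^ 2) ^ 2 := by rw [div_pow]

/-- `∑ m(ρ) (Im ĝ(ρ))²` converges for a test function. [folklore] -/
theorem summable_im_sq {g : ℝ → ℂ} (hg : IsWeilTest g) :
    Summable fun ρ : ZetaZeros.riemannZetaNontrivialZeros ↦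
      (riemannZetaZeroOrder (ρ : ℂ) : ℝ) * (weilMellin g ρ).im ^ 2 := by
  refine summable_zeroOrder_mul_of_le (x := fun ρ ↦ (weilMellin g ρ).im ^ 2)
    (K := weilDecayConst g ^ 2) (fun ρ _ ↦ sq_nonneg _) fun ρ hρ ↦ ?_
  have h := norm_weilMellin_le hg (ZetaZeros.riemannZetaNontrivialZeros.re_pos hρ).le
    (ZetaZeros.riemannZetaNontrivialZeros.re_lt_one hρ).le
  have h2 : |(weilMellin g ρ).im| ≤ weilDecayConst g / (1 + ρ.im ^ 2) :=
    (Complex.abs_im_le_norm _).trans h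
  calc (weilMellin g ρ).im ^ 2 = |(weilMellin g ρ).im| ^ 2 := (sq_abs _).symm
    _ ≤ (weilDecayConst g / (1 + ρ.im ^ 2)) ^ 2 := pow_le_pow_left₀ (abs_nonneg _) h2 2
    _ = weilDecayConst g ^ 2 / (1 + ρ.im ^ 2) ^ 2 := by rw [div_pow]

/-! ### The split in the two sectors -/

/-- **Hermitian sector** (`g(−x) = conj g(x)`): `Re Q(g) = ∑_ρ m (Re ĝ(ρ))² − ∑_ρ m (Im ĝ(ρ))²`; the
subtracted series vanishes termwise on the critical line (`im_weilMellin_eq_zero_of_hermitian`).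
[folklore] -/
theorem re_weilQuadratic_eq_of_hermitian {g : ℝ → ℂ} (hg : IsWeilTest g)
    (hh : ∀ x, g (-x) = conj (g x)) :
    (weilQuadratic g).re =
      (∑' ρ : ZetaZeros.riemannZetaNontrivialZeros,
        (riemannZetaZeroOrder (ρ : ℂ) : ℝ) * (weilMellin g ρ).re ^ 2) -
      ∑' ρ : ZetaZeros.riemannZetaNontrivialZeros,
        (riemannZetaZeroOrder (ρ : ℂ) : ℝ) * (weilMellin g ρ).im ^ 2 := by
  rw [re_weilQuadratic_eq_tsum_sub_tsum hg]
  congr 1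
  · refine tsum_congr fun ρ ↦ ?_
    rw [weilMellin_reflect_of_hermitian hh, (norm_sq_halves_of_conj _).1]
  · refine tsum_congr fun ρ ↦ ?_
    rw [weilMellin_reflect_of_hermitian hh, (norm_sq_halves_of_conj _).2]

/-- **Anti-hermitian sector** (`g(−x) = −conj g(x)`):
`Re Q(g) = ∑_ρ m (Im ĝ(ρ))² − ∑_ρ m (Re ĝ(ρ))²`; the subtracted series vanishes termwise on the
critical line (`re_weilMellin_eq_zero_of_antiHermitian`). [folklore] -/
theorem re_weilQuadratic_eq_of_antiHermitian {g : ℝ → ℂ} (hg : IsWeilTest g)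
    (hh : ∀ x, g (-x) = -conj (g x)) :
    (weilQuadratic g).re =
      (∑' ρ : ZetaZeros.riemannZetaNontrivialZeros,
        (riemannZetaZeroOrder (ρ : ℂ) : ℝ) * (weilMellin g ρ).im ^ 2) -
      ∑' ρ : ZetaZeros.riemannZetaNontrivialZeros,
        (riemannZetaZeroOrder (ρ : ℂ) : ℝ) * (weilMellin g ρ).re ^ 2 := by
  rw [re_weilQuadratic_eq_tsum_sub_tsum hg]
  have e1 : ∀ a : ℂ, (a + -conj a) / 2 = (a - conj a) / 2 := fun a ↦ by ring
  have e2 : ∀ a : ℂ, (a - -conj a) / 2 = (a + conj a) / 2 := fun a ↦ by ring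
  congr 1
  · refine tsum_congr fun ρ ↦ ?_
    rw [weilMellin_reflect_of_antiHermitian hh, e1, (norm_sq_halves_of_conj _).2]
  · refine tsum_congr fun ρ ↦ ?_
    rw [weilMellin_reflect_of_antiHermitian hh, e2, (norm_sq_halves_of_conj _).1]

/-- **Budget in the hermitian sector**: `Re Q(g) ≥ −∑_ρ m (Im ĝ(ρ))²`, a series carried by the
off-line zeros. [folklore] -/
theorem neg_tsum_im_sq_le_of_hermitian {g : ℝ → ℂ} (hg : IsWeilTest g)
    (hh : ∀ x, g (-x) = conj (g x)) :
    -(∑' ρ : ZetaZeros.riemannZetaNontrivialZeros,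
        (riemannZetaZeroOrder (ρ : ℂ) : ℝ) * (weilMellin g ρ).im ^ 2) ≤ (weilQuadratic g).re := by
  rw [re_weilQuadratic_eq_of_hermitian hg hh]
  have hm : ∀ ρ : ZetaZeros.riemannZetaNontrivialZeros, (0 : ℝ) ≤ riemannZetaZeroOrder (ρ : ℂ) :=
    fun ρ ↦ by exact_mod_cast riemannZetaZeroOrder_nonneg (ZetaZeros.riemannZetaNontrivialZeros.ne_one ρ.2)
  have h0 : 0 ≤ ∑' ρ : ZetaZeros.riemannZetaNontrivialZeros,
      (riemannZetaZeroOrder (ρ : ℂ) : ℝ) * (weilMellin g ρ).re ^ 2 :=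
    tsum_nonneg fun ρ ↦ mul_nonneg (hm ρ) (sq_nonneg _)
  linarith

/-- **Budget in the anti-hermitian sector**: `Re Q(g) ≥ −∑_ρ m (Re ĝ(ρ))²`, a series carried by the
off-line zeros (this is the series a Yoshida/Bombieri odd witness must make large). [folklore] -/
theorem neg_tsum_re_sq_le_of_antiHermitian {g : ℝ → ℂ} (hg : IsWeilTest g)
    (hh : ∀ x, g (-x) = -conj (g x)) :
    -(∑' ρ : ZetaZeros.riemannZetaNontrivialZeros,
        (riemannZetaZeroOrder (ρ : ℂ) : ℝ) * (weilMellin g ρ).re ^ 2) ≤ (weilQuadratic g).re := by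
  rw [re_weilQuadratic_eq_of_antiHermitian hg hh]
  have hm : ∀ ρ : ZetaZeros.riemannZetaNontrivialZeros, (0 : ℝ) ≤ riemannZetaZeroOrder (ρ : ℂ) :=
    fun ρ ↦ by exact_mod_cast riemannZetaZeroOrder_nonneg (ZetaZeros.riemannZetaNontrivialZeros.ne_one ρ.2)
  have h0 : 0 ≤ ∑' ρ : ZetaZeros.riemannZetaNontrivialZeros,
      (riemannZetaZeroOrder (ρ : ℂ) : ℝ) * (weilMellin g ρ).im ^ 2 :=
    tsum_nonneg fun ρ ↦ mul_nonneg (hm ρ) (sq_nonneg _)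
  linarith

/-! ### The sectors contain the classical witnesses -/

/-- An even real-valued `h`, modulated, is hermitian: `g(x) = h(x) e^{−iγ₀x}` has
`g(−x) = conj g(x)`. [folklore] -/
theorem hermitian_modulate_of_even_real {h : ℝ → ℂ} (heven : ∀ x, h (-x) = h x)
    (hreal : ∀ x, conj (h x) = h x) (γ₀ : ℝ) (x : ℝ) :
    h (-x) * cexp (-(((γ₀ * -x : ℝ) : ℂ) * I)) = conj (h x * cexp (-(((γ₀ * x : ℝ) : ℂ) * I))) := by
  rw [heven, map_mul, hreal, ← Complex.exp_conj]
  congr 2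
  simp only [map_neg, map_mul, Complex.conj_ofReal, Complex.conj_I]
  push_cast
  ring

/-- An odd real-valued `h`, modulated, is anti-hermitian: `g(x) = h(x) e^{−iγ₀x}` has
`g(−x) = −conj g(x)` (the modulated odd witness of Yoshida 1992 Prop. 1 / Bombieri 2000 §13).
[folklore] -/
theorem antiHermitian_modulate_of_odd_real {h : ℝ → ℂ} (hodd : ∀ x, h (-x) = -h x)
    (hreal : ∀ x, conj (h x) = h x) (γ₀ : ℝ) (x : ℝ) :
    h (-x) * cexp (-(((γ₀ * -x : ℝ) : ℂ) * I)) = -conj (h x * cexp (-(((γ₀ * x : ℝ) : ℂ) * I))) := by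
  rw [hodd, map_mul, hreal, ← Complex.exp_conj]
  simp only [map_neg, map_mul, Complex.conj_ofReal, Complex.conj_I]
  push_cast
  ring_nf

end Summit.RiemannHypothesis.RiemannHypothesis.Theorems.WeilOffLine

end
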